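import Summits.QuantumFields.GaugeBoot.Certificates.N1c2D3TabA
import HarnessLib

/-!
# Kernel checks of the reduced problem family `N1c2D3`, part 2/2 (gb_lean_emit_reduced 0.8.2)

HONEST FRAMING (cell `pub-gaugeboot`): certified bounds on lattice expectations at stated coupling,
gauge group, dimension and torus size; NOT a mass gap, NOT a continuum limit, NOT a string tension;
NOT Yang–Mills-summit-bearing (barriers `FixedCouplingUltralocality`, `PerturbativeInvisibility`).
Family `N1c2D3` (1449 variables, 18 reduced blocks of dimensions `dimL`, max 25; signature sha256
`9d78479e4706739c41f88e287ecc11ab8d1a828c4eed4296df1dbd18b262bc26`): the β-independent kernel checks of `Certificates/SparseReduced(Trace).lean`, run ONCE for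
every certificate of the family — `dimCheck` (entries outside a block's own dimension are empty), `shapeCheck`
(positions in range, strictly sorted ⇒ duplicate-free), `entCoverCheck` (every term of every entry is listed under its
variable) — held by `N1c2D3TabA`, `N1c2D3TabB` and assembled (`shape`, `cover`) in `N1c2D3Tab`.
Nothing is claimed about lattice gauge theory in this file.
-/

namespace Summit.QuantumFields.GaugeBoot.Certificates.N1c2D3

noncomputable section

open Matrix Summit.QuantumFields.GaugeBoot.Certificates.Sparse

set_option maxHeartbeats 0 in
/-- Kernel check: every term of every block entry is listed under its variable, blocks `10 ≤ k < 11`. -/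
theorem cover_8 : entCoverCheck EB P2 33 25 10 11 = true := by
  decide +kernel
set_option maxHeartbeats 0 in
/-- Kernel check: every term of every block entry is listed under its variable, blocks `11 ≤ k < 12`. -/
theorem cover_9 : entCoverCheck EB P2 33 25 11 12 = true := by
  decide +kernel
set_option maxHeartbeats 0 in
/-- Kernel check: every term of every block entry is listed under its variable, blocks `12 ≤ k < 13`. -/
theorem cover_10 : entCoverCheck EB P2 33 25 12 13 = true := by
  decide +kernel
set_option maxHeartbeats 0 in
/-- Kernel check: every term of every block entry is listed under its variable, blocks `13 ≤ k < 15`. -/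
theorem cover_11 : entCoverCheck EB P2 33 25 13 15 = true := by
  decide +kernel
set_option maxHeartbeats 0 in
/-- Kernel check: every term of every block entry is listed under its variable, blocks `15 ≤ k < 18`. -/
theorem cover_12 : entCoverCheck EB P2 33 25 15 18 = true := by
  decide +kernel

end

end Summit.QuantumFields.GaugeBoot.Certificates.N1c2D3
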